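import Literature.Analysis.UnboundedOperators.ClosableFormCriteria
import Literature.Analysis.OperatorTheory.CompactEmbeddingFormLevels
import HarnessLib

/-!
# Eigenfunctions and min–max levels of a semibounded symmetric operator with compact resolvent, read on its core

The three generic files
`Literature.Analysis.UnboundedOperators.ClosableFormCriteria` (Kato VI Thms 1.17/1.27: the form
`𝔥[f, g] = (S f, g)` of a symmetric operator `S ≥ 0` on a core `V` is closable; compactness of the
embedding `J` of the completed form domain from Rellich's criterion on the core),
`Literature.Analysis.OperatorTheory.CompactEmbeddingFormLevels` (form-eigenvectors and subspace
min–max levels in the `(Q, J)` format) and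
`Literature.Analysis.OperatorTheory.CompactPositiveSubspaceMinMax` are assembled here into ONE
statement entirely in the language of the CORE (no completion, no unbounded operator appears):

`exists_core_form_eigenseq` — let `V` be an infinite-dimensional inner product space (the core,
inner product `(𝔥 + 1)[f, g]`), `ι : V →L[𝕜] H` (the inclusion into the Hilbert space `H`),
`S : V → H` with `⟪f, g⟫_V = ⟪S f, ι g⟫_H + ⟪ι f, ι g⟫_H` (the operator on the core), and suppose
`ι` maps `V`-bounded sets to totally bounded sets (Rellich).  Then there are an ORTHONORMAL sequence
`u : ℕ → H` in the closure of `ι(V)` and levels `μ₀ ≤ μ₁ ≤ ⋯ → +∞` with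
* the WEAK EIGEN-EQUATION on the core: `⟪u_k, S g⟫_H = μ_k ⟪u_k, ι g⟫_H` for all `g ∈ V`
  (i.e. `u_k` is a distributional solution of `(S - μ_k) u = 0` — the input of elliptic
  regularity), and
* the MIN–MAX PRINCIPLE on the core: `μ_k = inf {s | ∃ W ⊆ V, dim W = k + 1, 𝔥[f] ≤ s ‖ι f‖² on W}`
  (`𝔥[f] = ‖f‖_V² - ‖ι f‖²`), an `IsGLB` (Reed–Simon IV, Thm XIII.2: min–max over a form core).

This is Reed–Simon IV, Thm XIII.64 ((iv) ⇒ (v): the Friedrichs extension of `S` has purely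
discrete spectrum with a complete set of eigenvectors) combined with Thm XIII.2, for the
Friedrichs extension defined through Kato's first representation theorem.

No definitions, no named facts, no instances, no notation.

## References
* [ReedSimonIV1978] Reed–Simon IV, §XIII.1 Thm XIII.2 (held p0084), §XIII.14 Thm XIII.64 (p. 245,
  held p0231).
* [Kato1966] Kato, VI §1.5 Thm 1.27 / Cor 1.28 (held p0374), §2.1 Thm 2.1 and §2.3 Thm 2.6
  (first representation theorem; the Friedrichs extension), held p0378–p0383.
-/

noncomputable section

open UniformSpace Filter _root_.Topology
open scoped InnerProductSpace ComplexConjugate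

namespace Literature.Analysis.UnboundedOperators

open Literature.Analysis.OperatorTheory

variable {𝕜 : Type*} [RCLike 𝕜]
variable {V : Type*} [NormedAddCommGroup V] [InnerProductSpace 𝕜 V]
variable {H : Type*} [NormedAddCommGroup H] [InnerProductSpace 𝕜 H] [CompleteSpace H]

/-- ★★ **Eigenfunctions and min–max levels of a semibounded symmetric operator with compact
resolvent, on its core** (Reed–Simon IV, Thm XIII.64 (iv)⇒(v) with Thm XIII.2; Kato VI Thm 1.27
for closability).  See the module docstring.
[cite: ReedSimonIV1978, Thm. XIII.64 ((iv) ⇒ (v)), §XIII.14 p. 245, and Thm. XIII.2 (min–max over a form core)] -/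
theorem exists_core_form_eigenseq (hV : ¬ FiniteDimensional 𝕜 V) (ι : V →L[𝕜] H) (S : V → H)
    (hS : ∀ f g : V, ⟪f, g⟫_𝕜 = ⟪S f, ι g⟫_𝕜 + ⟪ι f, ι g⟫_𝕜)
    (htb : ∀ r : ℝ, TotallyBounded (ι '' Metric.closedBall (0 : V) r)) :
    ∃ (u : ℕ → H) (μ : ℕ → ℝ), Orthonormal 𝕜 u ∧ Monotone μ ∧ (∀ k, -1 < μ k) ∧
      Tendsto μ atTop atTop ∧
      (∀ k, u k ∈ closure (Set.range ι)) ∧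
      (∀ k (g : V), ⟪u k, S g⟫_𝕜 = ((μ k : ℝ) : 𝕜) * ⟪u k, ι g⟫_𝕜) ∧
      ∀ k, IsGLB {s : ℝ | ∃ W : Submodule 𝕜 V, Module.finrank 𝕜 W = k + 1 ∧
        ∀ f ∈ W, ‖f‖ ^ 2 - ‖ι f‖ ^ 2 ≤ s * ‖ι f‖ ^ 2} (μ k) := by
  -- the symmetric form of `hS`
  have hS' : ∀ f g : V, ⟪f, g⟫_𝕜 = ⟪ι f, S g⟫_𝕜 + ⟪ι f, ι g⟫_𝕜 := fun f g => by
    rw [← inner_conj_symm, hS g f, map_add, inner_conj_symm, inner_conj_symm]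
  -- the embedding `J` of the completed form domain: injective (Kato 1.27) and compact (Rellich)
  set L : V →L[𝕜] Completion V := Completion.toComplL with hL
  set J : Completion V →L[𝕜] H := ι.extend L with hJ
  have hLcoe : ∀ f : V, L f = (f : Completion V) := fun f => by
    rw [hL]; exact congr_fun Completion.coe_toComplL f
  have hJcoe : ∀ f : V, J (f : Completion V) = ι f := fun f => extend_toComplL_coe ι f
  have hJi : Function.Injective J := extend_toComplL_injective_of_inner_eq ι S hS
  have hJc : IsCompactOperator J := isCompactOperator_extend_toComplL ι htb
  have hLi : Function.Injective (L : V →ₗ[𝕜] Completion V) := fun f g h => by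
    have h' : (f : Completion V) = g := by rw [← hLcoe, ← hLcoe]; exact h
    exact Completion.coe_injective V h'
  have hQ : ¬ FiniteDimensional 𝕜 (Completion V) := fun h =>
    hV (FiniteDimensional.of_injective (L : V →ₗ[𝕜] Completion V) hLi)
  -- the form eigen-sequence in the `(Q, J)` format
  obtain ⟨e, μ, hon, hmono, hμ1, hμlim, hJn, horth, hweak, hglb⟩ :=
    exists_form_eigenseq hQ J hJc hJi
  have hJe0 : ∀ k, 0 < ‖J (e k)‖ := fun k => by
    refine norm_pos_iff.2 fun h0 => ?_
    have h := hJn k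
    rw [h0, norm_zero, zero_pow two_ne_zero] at h
    have : 0 < (μ k + 1)⁻¹ := inv_pos.2 (by linarith [hμ1 k])
    linarith
  -- `J` maps into the closure of `ι(V)`, and `⟪x, g⟫_Q = ⟪J x, S g⟫ + ⟪J x, ι g⟫` for core `g`
  have hJcl : ∀ x : Completion V, J x ∈ closure (Set.range ι) := fun x =>
    Completion.induction_on x (isClosed_closure.preimage J.continuous)
      fun f => subset_closure ⟨f, (hJcoe f).symm⟩
  have hcore : ∀ (g : V) (x : Completion V),
      ⟪x, (g : Completion V)⟫_𝕜 = ⟪J x, S g⟫_𝕜 + ⟪J x, ι g⟫_𝕜 := fun g x =>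
    Completion.induction_on x
      (isClosed_eq (continuous_id.inner continuous_const)
        ((J.continuous.inner continuous_const).add (J.continuous.inner continuous_const)))
      fun f => by rw [Completion.inner_coe, hJcoe, hS' f g]
  have hweakJ : ∀ k (g : V), ⟪J (e k), S g⟫_𝕜 = ((μ k : ℝ) : 𝕜) * ⟪J (e k), ι g⟫_𝕜 := by
    intro k g
    have h1 := hweak k (g : Completion V)
    rw [hcore g (e k), hJcoe] at h1
    have h2 : ((μ k + 1 : ℝ) : 𝕜) = ((μ k : ℝ) : 𝕜) + 1 := by push_cast; ring
    rw [h2, add_mul, one_mul] at h1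
    exact add_right_cancel h1
  -- the normalised eigenfunctions `u_k = J e_k / ‖J e_k‖`
  set u : ℕ → H := fun k => ((‖J (e k)‖⁻¹ : ℝ) : 𝕜) • J (e k) with hu
  have hu_on : Orthonormal 𝕜 u := by
    refine ⟨fun k => ?_, fun i j hij => ?_⟩
    · simp only [hu]
      rw [norm_smul, RCLike.norm_ofReal, abs_of_pos (inv_pos.2 (hJe0 k)),
        inv_mul_cancel₀ (hJe0 k).ne']
    · simp only [hu]
      rw [inner_smul_left, inner_smul_right, horth i j hij, mul_zero, mul_zero]
  have hu_cl : ∀ k, u k ∈ closure (Set.range ι) := by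
    intro k
    have h1 : J (e k) ∈ (LinearMap.range (ι : V →ₗ[𝕜] H)).topologicalClosure := by
      rw [← SetLike.mem_coe, Submodule.topologicalClosure_coe, LinearMap.coe_range]
      exact hJcl (e k)
    have h2 := Submodule.smul_mem _ (((‖J (e k)‖⁻¹ : ℝ) : 𝕜)) h1
    rw [← SetLike.mem_coe, Submodule.topologicalClosure_coe, LinearMap.coe_range] at h2
    exact h2
  have hu_weak : ∀ k (g : V), ⟪u k, S g⟫_𝕜 = ((μ k : ℝ) : 𝕜) * ⟪u k, ι g⟫_𝕜 := by
    intro k g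
    simp only [hu]
    rw [inner_smul_left, inner_smul_left, hweakJ, mul_left_comm]
  -- the core as a dense subspace of the completion
  set D : Submodule 𝕜 (Completion V) := LinearMap.range (L : V →ₗ[𝕜] Completion V) with hD
  have hDd : Dense (D : Set (Completion V)) := by
    have h1 : (D : Set (Completion V)) = Set.range ((↑) : V → Completion V) := by
      rw [hD, LinearMap.coe_range]
      ext x
      constructor
      · rintro ⟨f, rfl⟩; exact ⟨f, (hLcoe f).symm⟩
      · rintro ⟨f, rfl⟩; exact ⟨f, hLcoe f⟩
    rw [h1]
    exact Completion.denseRange_coe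
  -- transport of trial subspaces between the core and its image in the completion
  have hnormL : ∀ f : V, ‖(L : V →ₗ[𝕜] Completion V) f‖ = ‖f‖ := fun f => by
    rw [ContinuousLinearMap.coe_coe, hLcoe, Completion.norm_coe]
  have hJL : ∀ f : V, J ((L : V →ₗ[𝕜] Completion V) f) = ι f := fun f => by
    rw [ContinuousLinearMap.coe_coe, hLcoe, hJcoe]
  have hSeq : ∀ k, {s : ℝ | ∃ W : Submodule 𝕜 V, Module.finrank 𝕜 W = k + 1 ∧
      ∀ f ∈ W, ‖f‖ ^ 2 - ‖ι f‖ ^ 2 ≤ s * ‖ι f‖ ^ 2} =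
      {s : ℝ | ∃ W : Submodule 𝕜 (Completion V), Module.finrank 𝕜 W = k + 1 ∧ W ≤ D ∧
        ∀ x ∈ W, ‖x‖ ^ 2 - ‖J x‖ ^ 2 ≤ s * ‖J x‖ ^ 2} := by
    intro k
    ext s
    constructor
    · rintro ⟨W, hW, hWs⟩
      refine ⟨W.map (L : V →ₗ[𝕜] Completion V), ?_, LinearMap.map_le_range, ?_⟩
      · rw [← (Submodule.equivMapOfInjective _ hLi W).finrank_eq, hW]
      · intro x hx
        obtain ⟨f, hf, rfl⟩ := Submodule.mem_map.1 hx
        rw [hnormL, hJL]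
        exact hWs f hf
    · rintro ⟨W', hW', hW'D, hW's⟩
      refine ⟨W'.comap (L : V →ₗ[𝕜] Completion V), ?_, ?_⟩
      · have hmap : (W'.comap (L : V →ₗ[𝕜] Completion V)).map (L : V →ₗ[𝕜] Completion V) = W' := by
          rw [Submodule.map_comap_eq, ← hD]
          exact inf_eq_right.2 hW'D
        rw [(Submodule.equivMapOfInjective _ hLi _).finrank_eq, hmap, hW']
      · intro f hf
        have h1 := hW's _ (Submodule.mem_comap.1 hf)
        rw [hnormL, hJL] at h1
        exact h1
  exact ⟨u, μ, hu_on, hmono, hμ1, hμlim, hu_cl, hu_weak, fun k => by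
    rw [hSeq k]; exact hglb D hDd k⟩

end Literature.Analysis.UnboundedOperators

end
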